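import Summits.NavierStokesRegularity.FluidComputer.RotorKnob
import Literature.Analysis.FluidPDE.Tao2016AveragedNS.RetunedFlow
import HarnessLib

/-!
# What no tuning can beat, part 13: THE KNOB IS CONTINUOUS — the knob flow, its Lipschitz
# dependence on the seed knob `ρ`, and PHASE SELECTION by the intermediate value theorem

Cell `pub-fluidc`, blueprint seat bp1 (gen 27); same namespace and conventions as parts 1–12
(`GateBudget*.lean`); imports `RotorKnob` (the two-scale family `rotorCircuit K M ε ρ`, its gate
decomposition, cancellation, `|Xᵢ| ≤ 1`) and the Literature file `RetunedFlow` (which brings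
`CircuitShadowing`: pseudo-orbits, the fundamental lemma `IsPseudoOrbit.norm_sub_le`, per-gate
Lipschitz constants; and `GlobalWellposedness`: existence / uniqueness for cancelling `C¹` fields).
HONEST FRAMING (verbatim): low prior, high value-of-information experiment on Tao's machine
paradigm; NOT a claim that NS blows up. Five-mode quadratic ODEs on `ℝ⁵`; Tao's (5.5) is the
member `ρ = ε`, `M = K¹⁰`; nothing is proved about the Navier–Stokes equations.

## What this part records (SPEC-INPUT-bp1 §U, item S13″c, ingredient (i) "knob continuity")

Part 12 (`GateBudgetNecessity`) turned robust firing of a member into an inequality on the seed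
knob `σ_knob = ρ²/ε` UNLESS the carrier exits the pulse in quadrature, and left PHASE SELECTION
open. Its topological half is settled here, for EVERY `K, M, ε` and every time `t ≥ 0`:
* §37 THE KNOB FLOW `knobFlow K M ε ρ σ p`: the member is polynomial (`contDiff_rotorCircuit`) and
  cancelling, hence globally well posed from every state; `knobFlow` is its flow (by choice;
  `knobFlow_zero`, `hasDerivAt_knobFlow`, `knobFlow_eq_of_hasDerivAt`, `energy_knobFlow`); at
  `ρ = ε` it is the Literature's retuned flow `delayFlowWith K M ε` (`knobFlow_self`).
* §38 THE LIPSCHITZ CONSTANT `knobLipschitz K M ε ρ R = 4R(ε + ρ²e^{-M} + ε⁻¹M + ρ⁻² + K)` of the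
  member on the sup-ball of radius `R` (gate by gate; `coe_knobLipschitz`; definitionally
  `delayLipschitzWith K M ε R` at `ρ = ε`) and the UNIFORM constant `knobLipschitzOn K M ε ρ₀ ρ₁ R`
  on a knob range `[ρ₀, ρ₁]`, `0 < ρ₀`.
* §39 THE KNOB DEFECT: two members differ by a pump of coupling `(ρ'² - ρ²)e^{-M}` and a rotor of
  coupling `ρ'⁻² - ρ⁻²` (`rotorCircuit_sub_eq`); on the unit ball the difference is at most
  `knobDefect M ρ ρ' = |ρ'⁻² - ρ⁻²| + |ρ'² - ρ²|e^{-M} ≤ 2ρ₁(ρ₀⁻⁴ + e^{-M})·|ρ - ρ'|`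
  (`norm_rotorCircuit_sub_le`, `knobDefect_le`): the exact trajectory of the member `ρ'` from
  (5.6) is a `knobDefect`-pseudo-orbit of the member `ρ` (`knob_isPseudoOrbit`).
* §40 TWO KNOBS, ONE DATUM (`knob_norm_sub_le`, `knob_abs_sub_le`, `norm_knobFlow_sub_le`):
  `‖X_ρ(t) - X_{ρ'}(t)‖ ≤ gronwallBound 0 L η t = (η/L)(e^{Lt} - 1)`, `L = knobLipschitz K M ε ρ 1`,
  `η = knobDefect M ρ ρ'` (the fundamental lemma); uniformly on a knob range
  (`norm_knobFlow_sub_le_of_mem_Icc`) the time-`t` state is LIPSCHITZ in the knob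
  (`lipschitzOnWith_knobFlow`, constant `2ρ₁(ρ₀⁻⁴ + e^{-M})·gronwallBound 0 L* 1 t`), hence
  continuous on `(0, ∞)` (`continuousOn_knobFlow_Ioi`, `continuousOn_knobFlow_apply`).
* §41 PHASE SELECTION (`knob_phase_selection`): every level between the values of a mode at time
  `t` for two knobs `0 < ρlo ≤ ρhi` is its value at time `t` for some knob `ρ ∈ [ρlo, ρhi]` — in
  particular, between a dud and a fired member there is one with ANY prescribed output level.

HONEST LIMITS. (1) EXISTENCE of a tuned knob, by continuity; nothing about HOW FINELY the knob
must be tuned — the certified modulus is Grönwall's, exponentially large in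
`L*·t ≍ 4(ε⁻¹M + ρ₀⁻² + K + …)t`, so the guaranteed tuning window for a prescribed level is only
`≳ e^{-L* t}` wide; whether the true window is polynomial (the cell's toy `data/g23-toy`: firing
bands `σ_n ≈ 1/(M(n + 0.56))` of width `≍ 1/M`) is NOT decided here. (2) A level at ONE time `t` is
not firing in Tao's sense (output `≥ 1 - δ` from some time ON); the output mode is monotone in time
(`RotorKnob.rotorCircuit_output_monotone`), so a level reached persists, but part 12's deficit
inequality still constrains which levels are reached robustly. (3) Nothing about Navier–Stokes.
`0` named facts; `0` sorry; three definitions by formula (`knobLipschitz`, `knobLipschitzOn`,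
`knobDefect`) and one by choice (`knobFlow`). [cite: Tao2016AveragedNS, §5 (ode)–(g-cancel),
§5.5 (5.5), (5.6), Theorem 5.3; HairerNorsettWanner1993, Thm I.10.2].
-/

noncomputable section

namespace Summit.NavierStokesRegularity.FluidComputer.GateBudget

open Real Set Metric Filter Topology
open scoped NNReal
open Literature.Analysis.FluidPDE.Tao2016AveragedNS

/-! ## §37 The knob flow: the member is smooth and globally well posed -/

/-- The member is a polynomial, hence smooth, vector field. [cite: Tao2016AveragedNS, §5.5 (5.5)] -/
theorem contDiff_rotorCircuit (K M ε ρ : ℝ) {n : WithTop ℕ∞} :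
    ContDiff ℝ n (RotorKnob.rotorCircuit K M ε ρ) := by
  rw [RotorKnob.rotorCircuit_eq_gates]
  exact ((((contDiff_pumpOn _ _ _).add (contDiff_pumpOn _ _ _)).add
    (contDiff_amplifierOn _ _ _)).add (contDiff_rotorOn _ _ _ _)).add (contDiff_pumpOn _ _ _)

/-- The member is globally well posed from EVERY state (cancellation + smoothness).
[cite: Tao2016AveragedNS, §5 (ode)–(g-cancel)] -/
theorem rotorCircuit_exists_solution_from (K M ε ρ : ℝ) (p : Fin 5 → ℝ) :
    ∃ X : ℝ → Fin 5 → ℝ, X 0 = p ∧ ∀ t, HasDerivAt X (RotorKnob.rotorCircuit K M ε ρ (X t)) t :=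
  (RotorKnob.isCancelling_rotorCircuit K M ε ρ).exists_solution (contDiff_rotorCircuit K M ε ρ) p

/-- Uniqueness among global trajectories of the member.
[cite: Tao2016AveragedNS, §5 (ode)–(g-cancel)] -/
theorem rotorCircuit_solution_unique (K M ε ρ : ℝ) {X Y : ℝ → Fin 5 → ℝ}
    (hX : ∀ t, HasDerivAt X (RotorKnob.rotorCircuit K M ε ρ (X t)) t)
    (hY : ∀ t, HasDerivAt Y (RotorKnob.rotorCircuit K M ε ρ (Y t)) t) (h : X 0 = Y 0) : X = Y :=
  (RotorKnob.isCancelling_rotorCircuit K M ε ρ).solution_unique (contDiff_rotorCircuit K M ε ρ)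
    hX hY h

/-- **The knob flow**: `knobFlow K M ε ρ σ p` = the state at rescaled time `σ` of the global
trajectory of the member `rotorCircuit K M ε ρ` issued from `p` (definition by choice;
characterised by `knobFlow_zero`, `hasDerivAt_knobFlow`, `knobFlow_eq_of_hasDerivAt`).
[cite: Tao2016AveragedNS, §5.5 (5.5)] -/
def knobFlow (K M ε ρ : ℝ) (σ : ℝ) (p : Fin 5 → ℝ) : Fin 5 → ℝ :=
  (rotorCircuit_exists_solution_from K M ε ρ p).choose σ

/-- The knob flow starts at the datum. [cite: Tao2016AveragedNS, §5.5 (5.5)] -/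
theorem knobFlow_zero (K M ε ρ : ℝ) (p : Fin 5 → ℝ) : knobFlow K M ε ρ 0 p = p :=
  (rotorCircuit_exists_solution_from K M ε ρ p).choose_spec.1

/-- The knob flow solves the member's ODE for all times. [cite: Tao2016AveragedNS, §5.5 (5.5)] -/
theorem hasDerivAt_knobFlow (K M ε ρ : ℝ) (p : Fin 5 → ℝ) (σ : ℝ) :
    HasDerivAt (fun σ' => knobFlow K M ε ρ σ' p)
      (RotorKnob.rotorCircuit K M ε ρ (knobFlow K M ε ρ σ p)) σ :=
  (rotorCircuit_exists_solution_from K M ε ρ p).choose_spec.2 σ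

/-- Uniqueness: a global trajectory of the member IS the knob-flow line of its initial state.
[cite: Tao2016AveragedNS, §5.5 (5.5)] -/
theorem knobFlow_eq_of_hasDerivAt {K M ε ρ : ℝ} {X : ℝ → Fin 5 → ℝ}
    (hX : ∀ t, HasDerivAt X (RotorKnob.rotorCircuit K M ε ρ (X t)) t) :
    (fun σ => knobFlow K M ε ρ σ (X 0)) = X :=
  rotorCircuit_solution_unique K M ε ρ (hasDerivAt_knobFlow K M ε ρ (X 0)) hX
    (knobFlow_zero K M ε ρ _)

/-- Dictionary: at `ρ = ε` the knob flow is the retuned flow `delayFlowWith K M ε` of the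
Literature (`RotorKnob.rotorCircuit_self`). [cite: Tao2016AveragedNS, §5.5 (5.5)] -/
theorem knobFlow_self (K M ε : ℝ) : knobFlow K M ε ε = delayFlowWith K M ε := by
  funext σ p
  have h := delayFlowWith_eq_of_hasDerivAt (K := K) (M := M) (ε := ε)
    (X := fun σ' => knobFlow K M ε ε σ' p) (fun t => by
      simpa [RotorKnob.rotorCircuit_self] using hasDerivAt_knobFlow K M ε ε p t)
  have := congrFun h σ
  simp only [knobFlow_zero] at this
  exact this.symm

/-- Energy is conserved along the knob flow. [cite: Tao2016AveragedNS, §5.5 (energy-con)] -/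
theorem energy_knobFlow (K M ε ρ : ℝ) (p : Fin 5 → ℝ) (σ : ℝ) :
    energy (knobFlow K M ε ρ σ p) = energy p := by
  have h := RotorKnob.rotorCircuit_energy (hasDerivAt_knobFlow K M ε ρ p) σ 0
  rwa [knobFlow_zero] at h

/-- A trajectory of a member from (5.6) lives in the closed unit sup-ball.
[cite: Tao2016AveragedNS, §5.5 (est)] -/
theorem norm_traj_le_one {K M ε ρ : ℝ} {X : ℝ → Fin 5 → ℝ}
    (hX : ∀ t, HasDerivAt X (RotorKnob.rotorCircuit K M ε ρ (X t)) t) (h0 : X 0 = delayInit)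
    (t : ℝ) : ‖X t‖ ≤ 1 :=
  (pi_norm_le_iff_of_nonneg zero_le_one).2 fun i => by
    rw [Real.norm_eq_abs]; exact RotorKnob.traj_abs_le_one hX h0 t i

/-! ## §38 The Lipschitz constant of the member on sup-balls, uniformly on a knob range -/

/-- **Explicit Lipschitz constant of the member** on the sup-ball of radius `R`: the sum of the
five gate constants `4|κ|R` over the couplings `ε`, `ρ²e^{-M}`, `ε⁻¹M`, `ρ⁻²`, `K`.
[cite: Tao2016AveragedNS, §5.5 (5.5)] -/
def knobLipschitz (K M ε ρ : ℝ) (R : ℝ≥0) : ℝ≥0 :=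
  4 * ‖ε‖₊ * R + 4 * ‖ρ ^ 2 * Real.exp (-M)‖₊ * R + 4 * ‖ε⁻¹ * M‖₊ * R +
    4 * ‖(ρ ^ 2)⁻¹‖₊ * R + 4 * ‖K‖₊ * R

/-- The member is `knobLipschitz K M ε ρ R`-Lipschitz on the sup-ball of radius `R` (gate by gate,
via `RotorKnob.rotorCircuit_eq_gates`). [cite: Tao2016AveragedNS, §5.5 (5.5)] -/
theorem lipschitzOnWith_rotorCircuit (K M ε ρ : ℝ) (R : ℝ≥0) :
    LipschitzOnWith (knobLipschitz K M ε ρ R) (RotorKnob.rotorCircuit K M ε ρ)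
      (closedBall (0 : Fin 5 → ℝ) R) := by
  rw [RotorKnob.rotorCircuit_eq_gates]
  exact ((((lipschitzOnWith_pumpOn ε 0 1 R).add
    (lipschitzOnWith_pumpOn (ρ ^ 2 * Real.exp (-M)) 0 2 R)).add
    (lipschitzOnWith_amplifierOn (ε⁻¹ * M) 1 2 R)).add
    (lipschitzOnWith_rotorOn ((ρ ^ 2)⁻¹) 0 3 2 R)).add (lipschitzOnWith_pumpOn K 3 4 R)

/-- The constant in real terms: `knobLipschitz K M ε ρ R = 4R(ε + ρ²e^{-M} + ε⁻¹M + ρ⁻² + K)` for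
`ε > 0`, `K, M ≥ 0`. [cite: Tao2016AveragedNS, §5.5 (5.5)] -/
theorem coe_knobLipschitz {K M ε : ℝ} (hK : 0 ≤ K) (hM : 0 ≤ M) (hε : 0 < ε) (ρ : ℝ) (R : ℝ≥0) :
    (knobLipschitz K M ε ρ R : ℝ) =
      4 * R * (ε + ρ ^ 2 * Real.exp (-M) + ε⁻¹ * M + (ρ ^ 2)⁻¹ + K) := by
  simp only [knobLipschitz, NNReal.coe_add, NNReal.coe_mul, NNReal.coe_ofNat, coe_nnnorm,
    Real.norm_eq_abs]
  rw [abs_of_pos hε, abs_of_nonneg (by positivity : (0 : ℝ) ≤ ρ ^ 2 * Real.exp (-M)),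
    abs_of_nonneg (by positivity : (0 : ℝ) ≤ ε⁻¹ * M),
    abs_of_nonneg (by positivity : (0 : ℝ) ≤ (ρ ^ 2)⁻¹), abs_of_nonneg hK]
  ring

/-- **Uniform Lipschitz constant on a knob range** `[ρ₀, ρ₁]`: the seed coupling at `ρ₁`, the
rotor coupling at `ρ₀`. [cite: Tao2016AveragedNS, §5.5 (5.5)] -/
def knobLipschitzOn (K M ε ρ₀ ρ₁ : ℝ) (R : ℝ≥0) : ℝ≥0 :=
  4 * ‖ε‖₊ * R + 4 * ‖ρ₁ ^ 2 * Real.exp (-M)‖₊ * R + 4 * ‖ε⁻¹ * M‖₊ * R +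
    4 * ‖(ρ₀ ^ 2)⁻¹‖₊ * R + 4 * ‖K‖₊ * R

/-- On `[ρ₀, ρ₁]` (`0 < ρ₀`) every member's constant is at most the uniform one.
[cite: Tao2016AveragedNS, §5.5 (5.5)] -/
theorem knobLipschitz_le_knobLipschitzOn {ρ₀ ρ₁ ρ : ℝ} (hρ₀ : 0 < ρ₀) (hρ : ρ ∈ Icc ρ₀ ρ₁)
    (K M ε : ℝ) (R : ℝ≥0) : knobLipschitz K M ε ρ R ≤ knobLipschitzOn K M ε ρ₀ ρ₁ R := by
  have hρp : 0 < ρ := hρ₀.trans_le hρ.1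
  have h1 : ‖ρ ^ 2 * Real.exp (-M)‖₊ ≤ ‖ρ₁ ^ 2 * Real.exp (-M)‖₊ := by
    rw [← NNReal.coe_le_coe, coe_nnnorm, coe_nnnorm, Real.norm_eq_abs, Real.norm_eq_abs,
      abs_of_nonneg (by positivity), abs_of_nonneg (by positivity)]
    exact mul_le_mul_of_nonneg_right (pow_le_pow_left₀ hρp.le hρ.2 2) (Real.exp_pos _).le
  have h2 : ‖(ρ ^ 2)⁻¹‖₊ ≤ ‖(ρ₀ ^ 2)⁻¹‖₊ := by
    rw [← NNReal.coe_le_coe, coe_nnnorm, coe_nnnorm, Real.norm_eq_abs, Real.norm_eq_abs,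
      abs_of_nonneg (by positivity), abs_of_nonneg (by positivity)]
    exact inv_anti₀ (by positivity) (pow_le_pow_left₀ hρ₀.le hρ.1 2)
  unfold knobLipschitz knobLipschitzOn
  gcongr

/-! ## §39 The knob defect: two members differ by a pump and a rotor -/

/-- **The knob defect** `|ρ'⁻² - ρ⁻²| + |ρ'² - ρ²|e^{-M}`: the size, on the unit sup-ball, of the
difference of the members `ρ'` and `ρ`. [cite: Tao2016AveragedNS, §5.5 (5.5)] -/
def knobDefect (M ρ ρ' : ℝ) : ℝ := |(ρ' ^ 2)⁻¹ - (ρ ^ 2)⁻¹| + |ρ' ^ 2 - ρ ^ 2| * Real.exp (-M)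

/-- Two members differ by a pump `0 → 2` of coupling `(ρ'² - ρ²)e^{-M}` and a rotor `0,3;2` of
coupling `ρ'⁻² - ρ⁻²`; mode by mode: [cite: Tao2016AveragedNS, §5.5 (5.5)] -/
theorem rotorCircuit_sub_eq (K M ε ρ ρ' : ℝ) (x : Fin 5 → ℝ) :
    RotorKnob.rotorCircuit K M ε ρ' x - RotorKnob.rotorCircuit K M ε ρ x =
      ![-(((ρ' ^ 2)⁻¹ - (ρ ^ 2)⁻¹) * x 2 * x 3) - (ρ' ^ 2 - ρ ^ 2) * exp (-M) * x 0 * x 2, 0,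
        (ρ' ^ 2 - ρ ^ 2) * exp (-M) * x 0 ^ 2, ((ρ' ^ 2)⁻¹ - (ρ ^ 2)⁻¹) * x 2 * x 0, 0] := by
  ext l
  fin_cases l <;> simp [RotorKnob.rotorCircuit] <;> ring

/-- Sup norm of a five-vector with two vanishing modes. [folklore] -/
theorem norm_vec5_le {a c d B : ℝ} (hB : 0 ≤ B) (h0 : |a| ≤ B) (h2 : |c| ≤ B) (h3 : |d| ≤ B) :
    ‖(![a, 0, c, d, 0] : Fin 5 → ℝ)‖ ≤ B := by
  refine (pi_norm_le_iff_of_nonneg hB).2 fun l => ?_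
  fin_cases l <;> simp [Real.norm_eq_abs, hB] <;> assumption

/-- **The knob defect bounds the difference of two members on the unit sup-ball**:
`‖X_{ρ'}(x) - X_ρ(x)‖ ≤ knobDefect M ρ ρ'` for `‖x‖ ≤ 1`. [cite: Tao2016AveragedNS, §5.5 (5.5)] -/
theorem norm_rotorCircuit_sub_le {K M ε ρ ρ' : ℝ} {x : Fin 5 → ℝ} (hx : ‖x‖ ≤ 1) :
    ‖RotorKnob.rotorCircuit K M ε ρ' x - RotorKnob.rotorCircuit K M ε ρ x‖ ≤ knobDefect M ρ ρ' := by
  have h1 : ∀ i, |x i| ≤ 1 := abs_apply_le_of_norm_le hx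
  have hp : ∀ i j, |x i * x j| ≤ 1 := fun i j => by
    rw [abs_mul]
    nlinarith [h1 i, h1 j, abs_nonneg (x i), abs_nonneg (x j)]
  rw [rotorCircuit_sub_eq]
  set A := (ρ' ^ 2)⁻¹ - (ρ ^ 2)⁻¹ with hA
  set B := (ρ' ^ 2 - ρ ^ 2) * exp (-M) with hB
  have hAB : knobDefect M ρ ρ' = |A| + |B| := by
    rw [knobDefect, hB, abs_mul, abs_of_pos (exp_pos _)]
  have hnn : 0 ≤ |A| + |B| := by positivity
  have e : ∀ (C : ℝ) i j, |C * x i * x j| ≤ |C| := fun C i j => by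
    rw [mul_assoc, abs_mul]; exact mul_le_of_le_one_right (abs_nonneg _) (hp i j)
  have c0 : |-(A * x 2 * x 3) - B * x 0 * x 2| ≤ |A| + |B| := by
    calc |-(A * x 2 * x 3) - B * x 0 * x 2| ≤ |-(A * x 2 * x 3)| + |B * x 0 * x 2| := abs_sub _ _
      _ ≤ |A| + |B| := by rw [abs_neg]; exact add_le_add (e A 2 3) (e B 0 2)
  have c2 : |B * x 0 ^ 2| ≤ |A| + |B| := by
    rw [pow_two, ← mul_assoc]; linarith [e B 0 0, abs_nonneg A]
  have c3 : |A * x 2 * x 0| ≤ |A| + |B| := by linarith [e A 2 0, abs_nonneg B]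
  rw [hAB]
  exact norm_vec5_le hnn c0 c2 c3

/-- **The knob defect is Lipschitz in the knob** on a range `[ρ₀, ρ₁]`, `0 < ρ₀`:
`knobDefect M ρ ρ' ≤ 2ρ₁(ρ₀⁻⁴ + e^{-M})·|ρ - ρ'|`. [folklore] -/
theorem knobDefect_le {M ρ₀ ρ₁ ρ ρ' : ℝ} (hρ₀ : 0 < ρ₀) (hρ : ρ ∈ Icc ρ₀ ρ₁)
    (hρ' : ρ' ∈ Icc ρ₀ ρ₁) :
    knobDefect M ρ ρ' ≤ 2 * ρ₁ * ((ρ₀ ^ 4)⁻¹ + exp (-M)) * |ρ - ρ'| := by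
  have hρp : 0 < ρ := hρ₀.trans_le hρ.1; have hρ'p : 0 < ρ' := hρ₀.trans_le hρ'.1
  have hρ₁ : 0 < ρ₁ := hρp.trans_le hρ.2
  have e1 : |ρ' ^ 2 - ρ ^ 2| ≤ 2 * ρ₁ * |ρ - ρ'| := by
    rw [show ρ' ^ 2 - ρ ^ 2 = (ρ' + ρ) * (ρ' - ρ) by ring, abs_mul, abs_sub_comm ρ' ρ,
      abs_of_pos (by linarith : 0 < ρ' + ρ)]
    exact mul_le_mul_of_nonneg_right (by linarith [hρ.2, hρ'.2]) (abs_nonneg _)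
  have hden : ρ₀ ^ 4 ≤ ρ ^ 2 * ρ' ^ 2 := by
    nlinarith [mul_le_mul_of_nonneg_right (pow_le_pow_left₀ hρ₀.le hρ.1 2) (sq_nonneg ρ₀),
      mul_le_mul_of_nonneg_left (pow_le_pow_left₀ hρ₀.le hρ'.1 2) (sq_nonneg ρ)]
  have e2 : |(ρ' ^ 2)⁻¹ - (ρ ^ 2)⁻¹| ≤ 2 * ρ₁ * (ρ₀ ^ 4)⁻¹ * |ρ - ρ'| := by
    have : (ρ' ^ 2)⁻¹ - (ρ ^ 2)⁻¹ = (ρ ^ 2 - ρ' ^ 2) / (ρ ^ 2 * ρ' ^ 2) := by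
      field_simp
    rw [this, abs_div, abs_of_pos (by positivity : 0 < ρ ^ 2 * ρ' ^ 2),
      div_le_iff₀ (by positivity : 0 < ρ ^ 2 * ρ' ^ 2), abs_sub_comm]
    calc |ρ' ^ 2 - ρ ^ 2| ≤ 2 * ρ₁ * |ρ - ρ'| := e1
      _ = 2 * ρ₁ * (ρ₀ ^ 4)⁻¹ * |ρ - ρ'| * ρ₀ ^ 4 := by field_simp
      _ ≤ 2 * ρ₁ * (ρ₀ ^ 4)⁻¹ * |ρ - ρ'| * (ρ ^ 2 * ρ' ^ 2) :=
          mul_le_mul_of_nonneg_left hden (by positivity)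
  calc knobDefect M ρ ρ' = |(ρ' ^ 2)⁻¹ - (ρ ^ 2)⁻¹| + |ρ' ^ 2 - ρ ^ 2| * exp (-M) := rfl
    _ ≤ 2 * ρ₁ * (ρ₀ ^ 4)⁻¹ * |ρ - ρ'| + 2 * ρ₁ * |ρ - ρ'| * exp (-M) :=
        add_le_add e2 (mul_le_mul_of_nonneg_right e1 (exp_pos _).le)
    _ = 2 * ρ₁ * ((ρ₀ ^ 4)⁻¹ + exp (-M)) * |ρ - ρ'| := by ring

/-- An exact trajectory of a member from (5.6) is a `0`-pseudo-orbit of that member in the unit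
ball, on every window. [cite: HairerNorsettWanner1993, Thm I.10.2] -/
theorem knob_isPseudoOrbit_self {K M ε ρ : ℝ} {X : ℝ → Fin 5 → ℝ}
    (hX : ∀ t, HasDerivAt X (RotorKnob.rotorCircuit K M ε ρ (X t)) t) (h0 : X 0 = delayInit)
    (T : ℝ) : IsPseudoOrbit (RotorKnob.rotorCircuit K M ε ρ) 0 1 T X :=
  IsPseudoOrbit.of_hasDerivAt hX fun t _ => by simpa using norm_traj_le_one hX h0 t

/-- **The exact trajectory of the member `ρ'` from (5.6) is a `knobDefect M ρ ρ'`-pseudo-orbit of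
the member `ρ`** in the unit ball, on every window. [cite: HairerNorsettWanner1993, Thm I.10.2] -/
theorem knob_isPseudoOrbit {K M ε ρ' : ℝ} {X' : ℝ → Fin 5 → ℝ}
    (hX' : ∀ t, HasDerivAt X' (RotorKnob.rotorCircuit K M ε ρ' (X' t)) t) (h0' : X' 0 = delayInit)
    (ρ T : ℝ) : IsPseudoOrbit (RotorKnob.rotorCircuit K M ε ρ) (knobDefect M ρ ρ') 1 T X' where
  continuousOn := fun t _ => (hX' t).continuousAt.continuousWithinAt
  defect := fun t _ =>
    ⟨_, (hX' t).hasDerivWithinAt, norm_rotorCircuit_sub_le (norm_traj_le_one hX' h0' t)⟩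
  norm_le := fun t _ => by simpa using norm_traj_le_one hX' h0' t

/-! ## §40 Two knobs, one datum: the fundamental lemma, and Lipschitz dependence on the knob -/

/-- **Two knobs, one datum.** The exact trajectories of the members `ρ` and `ρ'` from (5.6) stay
within `gronwallBound 0 L η t = (η/L)(e^{Lt} - 1)` of each other, `L = knobLipschitz K M ε ρ 1`,
`η = knobDefect M ρ ρ'` (HNW Thm I.10.2 with `ϱ = 0`).
[cite: HairerNorsettWanner1993, Thm I.10.2] -/
theorem knob_norm_sub_le {K M ε ρ ρ' : ℝ} {X X' : ℝ → Fin 5 → ℝ}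
    (hX : ∀ t, HasDerivAt X (RotorKnob.rotorCircuit K M ε ρ (X t)) t) (h0 : X 0 = delayInit)
    (hX' : ∀ t, HasDerivAt X' (RotorKnob.rotorCircuit K M ε ρ' (X' t)) t) (h0' : X' 0 = delayInit)
    {t : ℝ} (ht : 0 ≤ t) :
    ‖X t - X' t‖ ≤ gronwallBound 0 (knobLipschitz K M ε ρ 1) (knobDefect M ρ ρ') t := by
  have h := IsPseudoOrbit.norm_sub_le (lipschitzOnWith_rotorCircuit K M ε ρ 1)
    (knob_isPseudoOrbit_self hX h0 t) (knob_isPseudoOrbit hX' h0' ρ t) (δ₀ := 0)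
    (by rw [h0, h0', sub_self, norm_zero]) (t := t) ⟨ht, le_rfl⟩
  simpa using h

/-- Mode by mode. [cite: HairerNorsettWanner1993, Thm I.10.2] -/
theorem knob_abs_sub_le {K M ε ρ ρ' : ℝ} {X X' : ℝ → Fin 5 → ℝ}
    (hX : ∀ t, HasDerivAt X (RotorKnob.rotorCircuit K M ε ρ (X t)) t) (h0 : X 0 = delayInit)
    (hX' : ∀ t, HasDerivAt X' (RotorKnob.rotorCircuit K M ε ρ' (X' t)) t) (h0' : X' 0 = delayInit)
    {t : ℝ} (ht : 0 ≤ t) (i : Fin 5) :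
    |X t i - X' t i| ≤ gronwallBound 0 (knobLipschitz K M ε ρ 1) (knobDefect M ρ ρ') t := by
  simpa using abs_apply_le_of_norm_le (knob_norm_sub_le hX h0 hX' h0' ht) i

/-- `gronwallBound` with zero initial discrepancy is linear in the defect. [folklore] -/
theorem gronwallBound_init_zero_eq_mul (L η t : ℝ) :
    gronwallBound 0 L η t = η * gronwallBound 0 L 1 t := by
  by_cases hL : L = 0
  · subst hL; simp only [gronwallBound_K0]; ring
  · simp only [gronwallBound_of_K_ne_0 hL]; ring

/-- Flow form: `‖knobFlow ρ t (5.6) - knobFlow ρ' t (5.6)‖ ≤ gronwallBound 0 L η t`.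
[cite: HairerNorsettWanner1993, Thm I.10.2] -/
theorem norm_knobFlow_sub_le (K M ε ρ ρ' : ℝ) {t : ℝ} (ht : 0 ≤ t) :
    ‖knobFlow K M ε ρ t delayInit - knobFlow K M ε ρ' t delayInit‖ ≤
      gronwallBound 0 (knobLipschitz K M ε ρ 1) (knobDefect M ρ ρ') t :=
  knob_norm_sub_le (hasDerivAt_knobFlow K M ε ρ delayInit) (knobFlow_zero K M ε ρ delayInit)
    (hasDerivAt_knobFlow K M ε ρ' delayInit) (knobFlow_zero K M ε ρ' delayInit) ht

/-- **Uniformly on a knob range** `[ρ₀, ρ₁]`, `0 < ρ₀`: the time-`t` states of two members from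
(5.6) differ by at most `gronwallBound 0 L* (2ρ₁(ρ₀⁻⁴ + e^{-M})·|ρ - ρ'|) t`,
`L* = knobLipschitzOn K M ε ρ₀ ρ₁ 1`. [cite: HairerNorsettWanner1993, Thm I.10.2] -/
theorem norm_knobFlow_sub_le_of_mem_Icc {K M ε ρ₀ ρ₁ ρ ρ' t : ℝ} (hρ₀ : 0 < ρ₀)
    (hρ : ρ ∈ Icc ρ₀ ρ₁) (hρ' : ρ' ∈ Icc ρ₀ ρ₁) (ht : 0 ≤ t) :
    ‖knobFlow K M ε ρ t delayInit - knobFlow K M ε ρ' t delayInit‖ ≤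
      gronwallBound 0 (knobLipschitzOn K M ε ρ₀ ρ₁ 1)
        (2 * ρ₁ * ((ρ₀ ^ 4)⁻¹ + exp (-M)) * |ρ - ρ'|) t := by
  have hF := (lipschitzOnWith_rotorCircuit K M ε ρ 1).weaken
    (knobLipschitz_le_knobLipschitzOn hρ₀ hρ K M ε 1)
  have hX := knob_isPseudoOrbit_self (hasDerivAt_knobFlow K M ε ρ delayInit)
    (knobFlow_zero K M ε ρ delayInit) t
  have hY := (knob_isPseudoOrbit (hasDerivAt_knobFlow K M ε ρ' delayInit)
    (knobFlow_zero K M ε ρ' delayInit) ρ t).mono (knobDefect_le hρ₀ hρ hρ') le_rfl le_rfl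
  have h := IsPseudoOrbit.norm_sub_le hF hX hY (δ₀ := 0)
    (by rw [knobFlow_zero, knobFlow_zero, sub_self, norm_zero]) (t := t) ⟨ht, le_rfl⟩
  simpa using h

/-- **The time-`t` state is Lipschitz in the knob** on `[ρ₀, ρ₁]`, `0 < ρ₀`, with constant
`2ρ₁(ρ₀⁻⁴ + e^{-M})·gronwallBound 0 L* 1 t`. [cite: HairerNorsettWanner1993, Thm I.10.2] -/
theorem lipschitzOnWith_knobFlow (K M ε : ℝ) {ρ₀ ρ₁ t : ℝ} (hρ₀ : 0 < ρ₀) (ht : 0 ≤ t) :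
    LipschitzOnWith
      (Real.toNNReal (2 * ρ₁ * ((ρ₀ ^ 4)⁻¹ + exp (-M)) *
        gronwallBound 0 (knobLipschitzOn K M ε ρ₀ ρ₁ 1) 1 t))
      (fun ρ => knobFlow K M ε ρ t delayInit) (Icc ρ₀ ρ₁) := by
  refine LipschitzOnWith.of_dist_le_mul fun ρ hρ ρ' hρ' => ?_
  rw [dist_eq_norm, Real.dist_eq]
  calc ‖knobFlow K M ε ρ t delayInit - knobFlow K M ε ρ' t delayInit‖
      ≤ gronwallBound 0 (knobLipschitzOn K M ε ρ₀ ρ₁ 1)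
          (2 * ρ₁ * ((ρ₀ ^ 4)⁻¹ + exp (-M)) * |ρ - ρ'|) t :=
        norm_knobFlow_sub_le_of_mem_Icc hρ₀ hρ hρ' ht
    _ = 2 * ρ₁ * ((ρ₀ ^ 4)⁻¹ + exp (-M)) *
          gronwallBound 0 (knobLipschitzOn K M ε ρ₀ ρ₁ 1) 1 t * |ρ - ρ'| := by
        rw [gronwallBound_init_zero_eq_mul]; ring
    _ ≤ _ := mul_le_mul_of_nonneg_right (Real.le_coe_toNNReal _) (abs_nonneg _)

/-- **Knob continuity** on every compact knob range. [cite: HairerNorsettWanner1993, Thm I.10.2] -/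
theorem continuousOn_knobFlow_Icc (K M ε : ℝ) {ρ₀ ρ₁ t : ℝ} (hρ₀ : 0 < ρ₀) (ht : 0 ≤ t) :
    ContinuousOn (fun ρ => knobFlow K M ε ρ t delayInit) (Icc ρ₀ ρ₁) :=
  (lipschitzOnWith_knobFlow K M ε hρ₀ ht).continuousOn

/-- **Knob continuity**: for every `t ≥ 0` the time-`t` state of the member from (5.6) is a
continuous function of the knob `ρ ∈ (0, ∞)`. [cite: HairerNorsettWanner1993, Thm I.10.2] -/
theorem continuousOn_knobFlow_Ioi (K M ε : ℝ) {t : ℝ} (ht : 0 ≤ t) :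
    ContinuousOn (fun ρ => knobFlow K M ε ρ t delayInit) (Ioi 0) := by
  intro ρ hρ
  have hρ0 : 0 < ρ := hρ
  have h := continuousOn_knobFlow_Icc K M ε (ρ₀ := ρ / 2) (ρ₁ := 2 * ρ) (half_pos hρ0) ht
  exact (h.continuousAt (Icc_mem_nhds (by linarith) (by linarith))).continuousWithinAt

/-- Knob continuity, mode by mode (in particular for the output mode `4`).
[cite: HairerNorsettWanner1993, Thm I.10.2] -/
theorem continuousOn_knobFlow_apply (K M ε : ℝ) {t : ℝ} (ht : 0 ≤ t) (i : Fin 5) :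
    ContinuousOn (fun ρ => knobFlow K M ε ρ t delayInit i) (Ioi 0) :=
  (continuous_apply i).comp_continuousOn (continuousOn_knobFlow_Ioi K M ε ht)

/-! ## §41 Phase selection by the intermediate value theorem -/

/-- **Phase selection.** If `θ` lies between the values at time `t ≥ 0` of the mode `i` of the
members `ρlo` and `ρhi` (`0 < ρlo ≤ ρhi`; either orientation), then some member `ρ ∈ [ρlo, ρhi]`
has mode `i` EQUAL to `θ` at time `t` — e.g. between a dud and a fired member there is one with any
prescribed output level. Existence only: no tuning precision is asserted.
[cite: Tao2016AveragedNS, §5.5 Theorem 5.3] -/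
theorem knob_phase_selection {K M ε ρlo ρhi t θ : ℝ} (hlo : 0 < ρlo) (hle : ρlo ≤ ρhi)
    (ht : 0 ≤ t) (i : Fin 5)
    (hθ : θ ∈ uIcc (knobFlow K M ε ρlo t delayInit i) (knobFlow K M ε ρhi t delayInit i)) :
    ∃ ρ ∈ Icc ρlo ρhi, knobFlow K M ε ρ t delayInit i = θ := by
  have hc : ContinuousOn (fun ρ => knobFlow K M ε ρ t delayInit i) (uIcc ρlo ρhi) := by
    rw [uIcc_of_le hle]
    exact (continuousOn_knobFlow_apply K M ε ht i).mono fun ρ hρ => hlo.trans_le hρ.1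
  have h := intermediate_value_uIcc hc hθ; rwa [uIcc_of_le hle] at h

end Summit.NavierStokesRegularity.FluidComputer.GateBudget
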